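import Summits.BirchSwinnertonDyer.BirchSwinnertonDyer.Theorems.ThetaPartnerAtTwoSignedControlAtTwoShaThreePGroup
import Summits.BirchSwinnertonDyer.BirchSwinnertonDyer.Theorems.ThetaPartnerAtTwoSignedControlAtTwoShaThreeOddDescent
import Literature.NumberTheory.GaloisRepresentations.NumberFieldCdTwoProofs
import HarnessLib

/-!
# Milne I Thm. 4.10 (c)₃ — `H³(K, M) ↪ ⊕_{w real} H³(K_w, M)` — from the order-`2` trivial module:
# assembly of the dévissage (K4 `SignedControlAtTwo` stub 3 `stub_poitouTateThreeRealRat`)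

Route `ThetaPartnerAtTwo` (TP2; crux shared with `ResidualThetaTransportAtTwo`), crux K4 `SignedControlAtTwo`
(stmt-BirchSwinnertonDyer-20309), line `eulerchar` v12, registered stub
`stub_poitouTateThreeRealRat : poitouTate_three_realPlaces_injective ℚ`.  Seat `prover-bsd-wall-tp2-p3` (lead, gen 5).
Brick B4 of the lead's dévissage, assembling B1 (`…ShaThreeExtension`, extension step), B2 (`…ShaThreeOddDescent`,
odd-degree descent) and B3 (`…ShaThreePGroup`, `2`-group step):

* §1 `subsingleton_three_of_forall_two_nsmul` — **`H³(K, Q) = 0` for a finite discrete `Γ_K`-module `Q` without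
  `2`-torsion** (odd order): dévissage along the `p`-primary parts, `p` odd, each killed by Serre II §4.4 Prop. 13
  `cd_p(Γ_K) ≤ 2` (tree theorem `fieldCdLE_two_of_numberField_holds`).
* §2 `realThree_injective_of_isPrimaryTorsion_two` — **the `2`-primary case**, from three displayed hypotheses:
  (hSyl) every open normal subgroup `U ⊴ Γ_K` admits an "odd-degree `2`-Sylow splitting field" — a finite extension
  `F/K` of odd degree and `N₀ ⊴ Γ_F` of finite `2`-power index restricting into `U` (Galois theory: `F` = fixed field
  of a `2`-Sylow subgroup of `Γ_K/U`; NOT constructed here); (hbase) real-place injectivity of `H³(F, T)` for every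
  number field `F` and every trivial `Γ_F`-module `T` of order `2` (the class-field-theoretic base case); (h416) Milne
  I Cor. 4.16 for every number field (width seat's lane).  Proof: B2 descent to `F`, then B3 over `F`.
* §3 `poitouTate_three_realPlaces_injective_of_devissage` — **the named fact `poitouTate_three_realPlaces_injective K`
  BY NAME** from (hSyl) for `K`, (hbase), (h416): extension step B1 along `0 → M[2^N] → M → M/M[2^N] → 0` with §2 at the
  kernel and §1 at the quotient.

HONEST FRAMING: THEOREMS ONLY (no definition, no named fact, no `sorry`); CONDITIONAL on (hSyl) [pure Galois theory, to be
discharged], (hbase) [CFT: `Br(F)/2 ≅ ⊕_real ℤ/2`, `H³(F, 𝔾_m)[2] = 0`] and (h416); closes no item by itself; BSD is not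
proved by any of this.

References: [MilneADT2006] I Thm. 4.10 (c), Cor. 4.16; [SerreGaloisCohomology1997] I §3.3, II §4.4 Prop. 13.
-/

set_option autoImplicit false
-- the Theorems namespace of this sub repeats the summit name by design (D-0017 nested layout)
set_option linter.dupNamespace false

noncomputable section

open CategoryTheory NumberField Field Function
open _root_.TopRep _root_.ContRepresentation _root_.ContinuousCohomology
open Literature.NumberTheory.GaloisRepresentations
open Literature.NumberTheory.GaloisCohomology

namespace Summit.BirchSwinnertonDyer.BirchSwinnertonDyer.Theorems.SignedEC.ShaThree

variable {K : Type} [Field K] [NumberField K]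

/-! ## §0 Stable torsion submodules -/

section Torsion

variable {M : Type} [AddCommGroup M] [TopologicalSpace M] [DiscreteTopology M]

omit [NumberField K] in
/-- The `a`-torsion submodule is stable under every discrete `Γ_K`-module structure. [folklore] -/
theorem torsionBy_le_comap (ρ : DiscreteGaloisModule K M) (a : ℤ) (g : absoluteGaloisGroup K) :
    Submodule.torsionBy ℤ M a ≤ (Submodule.torsionBy ℤ M a).comap (ρ g) := by
  intro x hx
  rw [Submodule.mem_comap, Submodule.mem_torsionBy_iff]
  rw [Submodule.mem_torsionBy_iff] at hx
  rw [← map_zsmul, hx, map_zero]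

omit [Field K] [NumberField K] [TopologicalSpace M] [DiscreteTopology M] in
/-- In a group without `2`-torsion every element has odd order. [folklore] -/
theorem odd_addOrderOf_of_forall_two_nsmul [Finite M] (h2 : ∀ q : M, 2 • q = 0 → q = 0) (q : M) :
    Odd (addOrderOf q) := by
  by_contra hodd
  rw [Nat.not_odd_iff_even] at hodd
  obtain ⟨k, hk⟩ := hodd
  have hpos : 0 < addOrderOf q := addOrderOf_pos q
  have hkq : k • q = 0 := h2 _ (by rw [← mul_nsmul', two_mul, ← hk]; exact addOrderOf_nsmul_eq_zero q)
  have hdvd := addOrderOf_dvd_of_nsmul_eq_zero hkq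
  have hk0 : 0 < k := by omega
  have := Nat.le_of_dvd hk0 hdvd
  omega

end Torsion

/-! ## §1 Odd part: `H³(K, Q) = 0` for finite `Q` without `2`-torsion -/

section OddPart

/-- **`H³(K, Q) = 0` for a finite discrete `Γ_K`-module `Q` without `2`-torsion** (dévissage along the `p`-primary
parts, `p` odd; Serre II §4.4 Prop. 13 `cd_p(Γ_K) ≤ 2` for `p ≠ 2`, tree `fieldCdLE_two_of_numberField_holds`).
[cite: SerreGaloisCohomology1997, II §4.4 Prop. 13] [cite: SerreGaloisCohomology1997, I §3.3] -/
theorem subsingleton_three_of_forall_two_nsmul (Q : Type) [AddCommGroup Q] [TopologicalSpace Q]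
    [DiscreteTopology Q] [Finite Q] (τ : DiscreteGaloisModule K Q) (h2 : ∀ q : Q, 2 • q = 0 → q = 0) :
    Subsingleton (galoisCohomology τ 3) := by
  classical
  haveI : CompactSpace (absoluteGaloisGroup K) := absoluteGaloisGroup_compactSpace K
  suffices key : ∀ (n : ℕ) (Q : Type) [AddCommGroup Q] [TopologicalSpace Q] [DiscreteTopology Q] [Finite Q]
      (τ : DiscreteGaloisModule K Q), (∀ q : Q, 2 • q = 0 → q = 0) → Nat.card Q = n →
      Subsingleton (continuousCohomology 3 τ.toTopRep) from key _ Q τ h2 rfl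
  intro n
  induction n using Nat.strong_induction_on with
  | _ n ih =>
    intro Q _ _ _ _ τ h2 hn
    by_cases hsub : Subsingleton Q
    · exact subsingleton_continuousCohomology_of_subsingleton τ.toTopRep 2
    · haveI : Nontrivial Q := not_subsingleton_iff_nontrivial.1 hsub
      obtain ⟨q₀, hq₀⟩ := exists_ne (0 : Q)
      -- an odd prime `p` dividing the order of `q₀`
      have ho1 : 1 < addOrderOf q₀ := by
        have hpos := addOrderOf_pos q₀
        have hne : addOrderOf q₀ ≠ 1 := fun h => hq₀ (AddMonoid.addOrderOf_eq_one_iff.1 h)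
        omega
      set p := (addOrderOf q₀).minFac with hp
      haveI hpp : Fact p.Prime := ⟨Nat.minFac_prime ho1.ne'⟩
      have hpdvd : p ∣ addOrderOf q₀ := Nat.minFac_dvd _
      have hp2 : p ≠ 2 := by
        intro h
        have hodd := odd_addOrderOf_of_forall_two_nsmul h2 q₀
        exact (Nat.not_even_iff_odd.2 hodd) (even_iff_two_dvd.2 (h ▸ hpdvd))
      -- the `p`-primary part `W = Q[p^n]`
      let W : Submodule ℤ Q := Submodule.torsionBy ℤ Q ((p : ℤ) ^ n)
      have hW : ∀ g, W ≤ W.comap (τ g) := torsionBy_le_comap τ _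
      have hSES := isSES_subtype_mkQ τ W hW
      have hWp : IsPrimaryTorsion p W := fun w => ⟨n, by
        have hw := w.2
        rw [Submodule.mem_torsionBy_iff] at hw
        apply Subtype.ext
        change p ^ n • (w : Q) = 0
        rw [← natCast_zsmul, Nat.cast_pow]
        exact hw⟩
      -- `H³(W) = 0` by `cd_p(Γ_K) ≤ 2`
      have h₁ : Subsingleton (continuousCohomology 3 (τ.subrepresentation W hW).toTopRep) :=
        fieldCdLE_two_of_numberField_holds K p (Or.inl hp2) W (τ.subrepresentation W hW) hWp
          (by norm_num : 2 < 3)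
      -- the quotient: smaller, still without `2`-torsion
      haveI : Finite (Q ⧸ W) := Finite.of_surjective _ (Submodule.Quotient.mk_surjective W)
      have hn1 : 1 ≤ n := by rw [← hn]; exact Nat.one_le_iff_ne_zero.2 Nat.card_pos.ne'
      have hWnt : 1 < Nat.card W := by
        -- `(o/p) • q₀ ∈ W` is non-zero
        obtain ⟨k, hk⟩ := hpdvd
        have hk0 : 0 < k := Nat.pos_of_ne_zero fun h0 => by rw [h0, mul_zero] at hk; exact (addOrderOf_pos q₀).ne' hk
        have hne : k • q₀ ≠ 0 := fun h0 => by
          have := Nat.le_of_dvd hk0 (addOrderOf_dvd_of_nsmul_eq_zero h0)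
          have hlt : k < addOrderOf q₀ := by
            rw [hk]; exact (Nat.lt_mul_iff_one_lt_left hk0).2 hpp.out.one_lt
          omega
        have hmem : k • q₀ ∈ W := by
          rw [Submodule.mem_torsionBy_iff]
          change ((p : ℤ) ^ n) • (k • q₀) = 0
          rw [← Nat.cast_pow, natCast_zsmul, smul_smul]
          have hn' : n = (n - 1) + 1 := by omega
          rw [hn', pow_succ, mul_assoc, ← hk, ← smul_smul, addOrderOf_nsmul_eq_zero, smul_zero]
        rw [Finite.one_lt_card_iff_nontrivial]
        exact ⟨⟨⟨k • q₀, hmem⟩, 0, fun h => hne (congrArg Subtype.val h)⟩⟩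
      have hlt : Nat.card (Q ⧸ W) < n := by
        have hmul : Nat.card Q = Nat.card (Q ⧸ W) * Nat.card W :=
          AddSubgroup.card_eq_card_quotient_mul_card_addSubgroup W.toAddSubgroup
        rw [hn] at hmul
        rw [hmul]
        exact (Nat.lt_mul_iff_one_lt_right Nat.card_pos).2 hWnt
      have h2' : ∀ x : Q ⧸ W, 2 • x = 0 → x = 0 := fun x hx => by
        induction x using Submodule.Quotient.induction_on with
        | _ m =>
          have hmem : 2 • m ∈ W := by
            rw [← Submodule.Quotient.mk_eq_zero, Submodule.Quotient.mk_smul]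
            exact hx
          rw [Submodule.Quotient.mk_eq_zero, Submodule.mem_torsionBy_iff]
          rw [Submodule.mem_torsionBy_iff] at hmem
          change ((p : ℤ) ^ n) • (2 • m) = 0 at hmem
          change ((p : ℤ) ^ n) • m = 0
          rw [← Nat.cast_pow, natCast_zsmul] at hmem ⊢
          -- `ord m ∣ 2 p^n` and `ord m` odd, so `ord m ∣ p^n`
          have hd : addOrderOf m ∣ 2 * p ^ n := addOrderOf_dvd_of_nsmul_eq_zero (by rw [mul_comm, mul_nsmul', hmem])
          have hodd := odd_addOrderOf_of_forall_two_nsmul h2 m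
          have hd' : addOrderOf m ∣ p ^ n := (Nat.Coprime.dvd_of_dvd_mul_left (Nat.coprime_two_right.2 hodd) hd)
          exact addOrderOf_dvd_iff_nsmul_eq_zero.1 hd'
      have h₃ : Subsingleton (continuousCohomology 3 (τ.quotient W hW).toTopRep) :=
        ih _ hlt (Q ⧸ W) (τ.quotient W hW) h2' rfl
      exact hSES.subsingleton_X₂ 2 h₁ h₃

end OddPart

/-! ## §2 The `2`-primary case, from the odd-degree `2`-Sylow splitting field, the base case and Cor. 4.16 -/

section TwoPrimary

/-- **Real-place injectivity of `H³(K, M)` for finite `2`-primary `M`**, granted: (hSyl) odd-degree `2`-Sylow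
splitting fields over `K`; (hbase) the base case at the trivial module of order `2` over every number field; (h416)
Milne I Cor. 4.16 over every number field.  Proof: descend to `F` (B2 `realThree_injective_of_odd_extension`), where
`Γ_F` acts through the `2`-group `Γ_F/N₀` (B3 `realThree_injective_of_pGroup_quotient`).
[cite: MilneADT2006, Ch. I, Thm. 4.10 (c) and Cor. 4.16] [cite: SerreGaloisCohomology1997, I §3.3] -/
theorem realThree_injective_of_isPrimaryTorsion_two
    (hSyl : ∀ U : Subgroup (absoluteGaloisGroup K), U.Normal → IsOpen (U : Set (absoluteGaloisGroup K)) →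
      ∃ (F : Type) (_ : Field F) (_ : NumberField F) (_ : Algebra K F) (_ : FiniteDimensional K F)
        (N₀ : Subgroup (absoluteGaloisGroup F)) (_ : N₀.Normal) (_ : Finite (absoluteGaloisGroup F ⧸ N₀)),
        Odd (Module.finrank K F) ∧ IsPGroup 2 (absoluteGaloisGroup F ⧸ N₀) ∧
          N₀ ≤ U.comap (absGaloisRestrict K F : absoluteGaloisGroup F →* absoluteGaloisGroup K))
    (hbase : ∀ (F : Type) [Field F] [NumberField F] (T : Type) [AddCommGroup T] [TopologicalSpace T]
      [DiscreteTopology T] [Finite T] (σ : DiscreteGaloisModule F T),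
      (∀ (g : absoluteGaloisGroup F) (t : T), σ g t = t) → Nat.card T = 2 →
        ∀ c : galoisCohomology σ 3,
          (∀ w : InfinitePlace F, w.IsReal → galoisCohomology.localization σ (Sum.inl w) 3 c = 0) → c = 0)
    (h416 : ∀ (F : Type) [Field F] [NumberField F], poitouTate_two_realPlaces_surjective F)
    (M : Type) [AddCommGroup M] [TopologicalSpace M] [DiscreteTopology M] [Finite M]
    (ρ : DiscreteGaloisModule K M) (hM : IsPrimaryTorsion 2 M) :
    ∀ c : galoisCohomology ρ 3,
      (∀ w : InfinitePlace K, w.IsReal → galoisCohomology.localization ρ (Sum.inl w) 3 c = 0) → c = 0 := by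
  classical
  -- the kernel `U` of the action: open, normal, acting trivially
  let U : Subgroup (absoluteGaloisGroup K) := (ρ : absoluteGaloisGroup K →* (M →ₗ[ℤ] M)).ker
  haveI : U.Normal := MonoidHom.normal_ker _
  have hUmem : ∀ g, g ∈ U ↔ ∀ m : M, ρ g m = m := fun g => by
    rw [MonoidHom.mem_ker]
    constructor
    · intro h m
      have := LinearMap.congr_fun h m
      exact this
    · intro h
      exact LinearMap.ext h
  have hUopen : IsOpen (U : Set (absoluteGaloisGroup K)) := by
    have : (U : Set (absoluteGaloisGroup K)) = ⋂ m : M, {g | ρ g m = m} := by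
      ext g
      simp only [SetLike.mem_coe, Set.mem_iInter, Set.mem_setOf_eq]
      exact hUmem g
    rw [this]
    exact isOpen_iInter_of_finite fun m => ρ.isOpen_setOf_apply_eq m
  obtain ⟨F, _, _, _, _, N₀, _, _, hodd, hQ, hN₀U⟩ := hSyl U inferInstance hUopen
  -- a uniform exponent: `2 ^ r` kills `M`
  obtain ⟨r, hr⟩ := exists_card_eq_prime_pow M hM
  have hMr : ∀ m : M, (2 ^ r) • m = 0 := fun m => by
    haveI := Fintype.ofFinite M
    rw [← hr, Nat.card_eq_fintype_card]
    exact card_nsmul_eq_zero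
  -- over `F`: `N₀` acts trivially, `Γ_F/N₀` is a `2`-group
  have hN₀ : ∀ g ∈ N₀, ∀ b : M, (ρ.restrictField F) g b = b := fun g hg b => by
    have hg' := hN₀U hg
    rw [Subgroup.mem_comap] at hg'
    exact ((hUmem _).1 hg') b
  have hF := realThree_injective_of_pGroup_quotient (F := F) N₀ hQ (hbase F) (h416 F) M (ρ.restrictField F)
    hM hN₀
  exact realThree_injective_of_odd_extension ρ F hodd hMr hF

end TwoPrimary

/-! ## §3 The named fact from the dévissage -/

section Assembly

/-- **Milne I Thm. 4.10 (c)₃ — the named fact `poitouTate_three_realPlaces_injective K` — from the dévissage**: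
granted (hSyl) odd-degree `2`-Sylow splitting fields over `K` (Galois theory), (hbase) real-place injectivity of
`H³(F, T)` for trivial `T` of order `2` over every number field `F` (the CFT base case), and (h416) Milne I Cor. 4.16
over every number field, every class of `H³(K, M)` (`M` finite discrete) vanishing at all real places is `0`:
along `0 → M[2^N] → M → M/M[2^N] → 0`, §2 at the kernel, §1 (`H³ = 0`) at the quotient, B1's extension step.
[cite: MilneADT2006, Ch. I, Thm. 4.10 (c) and Cor. 4.16] [cite: SerreGaloisCohomology1997, II §4.4 Prop. 13] -/
theorem poitouTate_three_realPlaces_injective_of_devissage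
    (hSyl : ∀ U : Subgroup (absoluteGaloisGroup K), U.Normal → IsOpen (U : Set (absoluteGaloisGroup K)) →
      ∃ (F : Type) (_ : Field F) (_ : NumberField F) (_ : Algebra K F) (_ : FiniteDimensional K F)
        (N₀ : Subgroup (absoluteGaloisGroup F)) (_ : N₀.Normal) (_ : Finite (absoluteGaloisGroup F ⧸ N₀)),
        Odd (Module.finrank K F) ∧ IsPGroup 2 (absoluteGaloisGroup F ⧸ N₀) ∧
          N₀ ≤ U.comap (absGaloisRestrict K F : absoluteGaloisGroup F →* absoluteGaloisGroup K))
    (hbase : ∀ (F : Type) [Field F] [NumberField F] (T : Type) [AddCommGroup T] [TopologicalSpace T]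
      [DiscreteTopology T] [Finite T] (σ : DiscreteGaloisModule F T),
      (∀ (g : absoluteGaloisGroup F) (t : T), σ g t = t) → Nat.card T = 2 →
        ∀ c : galoisCohomology σ 3,
          (∀ w : InfinitePlace F, w.IsReal → galoisCohomology.localization σ (Sum.inl w) 3 c = 0) → c = 0)
    (h416 : ∀ (F : Type) [Field F] [NumberField F], poitouTate_two_realPlaces_surjective F) :
    poitouTate_three_realPlaces_injective K := by
  classical
  intro M _ _ _ _ ρ c hc
  haveI : CompactSpace (absoluteGaloisGroup K) := absoluteGaloisGroup_compactSpace K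
  -- the `2`-primary part `W = M[2^N]`, `N = #M`
  set N := Nat.card M with hN
  let W : Submodule ℤ M := Submodule.torsionBy ℤ M ((2 : ℤ) ^ N)
  have hW : ∀ g, W ≤ W.comap (ρ g) := torsionBy_le_comap ρ _
  have hSES := isSES_subtype_mkQ ρ W hW
  haveI : Finite W := Subtype.finite
  haveI : Finite (M ⧸ W) := Finite.of_surjective _ (Submodule.Quotient.mk_surjective W)
  have e2 : ((2 : ℤ) ^ N) = ((2 ^ N : ℕ) : ℤ) := by norm_cast
  have hW2 : IsPrimaryTorsion 2 W := fun w => ⟨N, by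
    have hw := w.2
    rw [Submodule.mem_torsionBy_iff, e2, natCast_zsmul] at hw
    exact Subtype.ext hw⟩
  -- the quotient has no `2`-torsion
  have hQ2 : ∀ x : M ⧸ W, 2 • x = 0 → x = 0 := fun x hx => by
    induction x using Submodule.Quotient.induction_on with
    | _ m =>
      have hmem : 2 • m ∈ W := by
        rw [← Submodule.Quotient.mk_eq_zero, Submodule.Quotient.mk_smul]
        exact hx
      rw [Submodule.Quotient.mk_eq_zero, Submodule.mem_torsionBy_iff, e2, natCast_zsmul]
      rw [Submodule.mem_torsionBy_iff, e2, natCast_zsmul] at hmem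
      -- hmem : 2 ^ N • 2 • m = 0
      have h2N : (2 ^ (N + 1)) • m = 0 := by
        rw [pow_succ, ← smul_smul]
        exact hmem
      -- `ord m` is a power of `2` at most `#M = N < 2^N`, so it divides `2^N`
      have hdvd : addOrderOf m ∣ 2 ^ (N + 1) := addOrderOf_dvd_of_nsmul_eq_zero h2N
      obtain ⟨j, _, hj⟩ := (Nat.dvd_prime_pow Nat.prime_two).1 hdvd
      have hle : addOrderOf m ≤ N := by
        rw [hN]
        haveI := Fintype.ofFinite M
        rw [Nat.card_eq_fintype_card]
        exact addOrderOf_le_card_univ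
      have hjN : j ≤ N := by
        have h2j : 2 ^ j ≤ N := hj ▸ hle
        exact (lt_of_lt_of_le (Nat.lt_two_pow_self) h2j).le
      have hdvd' : addOrderOf m ∣ 2 ^ N := hj ▸ Nat.pow_dvd_pow 2 hjN
      exact addOrderOf_dvd_iff_nsmul_eq_zero.1 hdvd'
  -- §2 at the kernel, §1 at the quotient, Cor. 4.16 at the quotient; B1's extension step
  have h1 := realThree_injective_of_isPrimaryTorsion_two hSyl hbase h416 W
    (show DiscreteGaloisModule K W from ρ.subrepresentation W hW) hW2
  have h3 : ∀ y : galoisCohomology (show DiscreteGaloisModule K (M ⧸ W) from ρ.quotient W hW) 3,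
      (∀ w : InfinitePlace K, w.IsReal →
        galoisCohomology.localization (show DiscreteGaloisModule K (M ⧸ W) from ρ.quotient W hW)
          (Sum.inl w) 3 y = 0) → y = 0 := fun y _ =>
    (subsingleton_three_of_forall_two_nsmul (M ⧸ W) (ρ.quotient W hW) hQ2).elim _ _
  have h2 := h416 K (M ⧸ W) (ρ.quotient W hW)
  exact IsSES.eq_zero_of_forall_localization_inl_three hSES h1 h3 h2 c hc

end Assembly

end Summit.BirchSwinnertonDyer.BirchSwinnertonDyer.Theorems.SignedEC.ShaThree

end
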